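import Summits.AtomisticToContinuum.HydrodynamicLimit.Theorems.CollisionIsometryCLTDiffuseBackwardInfluenceOnePathBound
import Summits.AtomisticToContinuum.HydrodynamicLimit.Theorems.CollisionIsometryCLTDiffuseBackwardInfluencePairDefs
import HarnessLib

/-!
# `DiffuseBackwardInfluence`, line `share-nondegeneracy-one-flight`, skeleton v7 — helper GEN1: generic algebra of the
marked one-event maps `kstep` / `stepT` / `stepA` of `…PairDefs` §3 (stmt-AtomisticToContinuum-12950, for `stub_pairPathBound`)

Finite-sum algebra of ONE exchange event, no physics: §K the one-tracer kernel (rows sum to one, squared host rows, split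
mass `2 f (1 − f)`); §M mark sums `sT`/`sA` and the marginal identities — summing out the marks `(s, t, g)` reproduces the
transported product law (`product_step`; registered headline `pairPath_product_step`); §S diagonal, nonnegativity, support
propagation; §D apart mass with an OLD slot tag is only transported (`sAle_stepA`), and the transport is monotone.
-/

namespace Summit.AtomisticToContinuum.HydrodynamicLimit.Theorems.DiffuseBackwardInfluenceShare

open scoped BigOperators Topology ENNReal InnerProductSpace Classical
open Filter Set MeasureTheory
open Literature.Analysis.FluidPDE (Config HardSphereFlow collidePair)
open Literature.MathematicalPhysics.KineticTheory (localGibbsLaw hsDiameter)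
open Summit.AtomisticToContinuum.HydrodynamicLimit.Theorems.DiffuseBackwardInfluenceNeg

noncomputable section

namespace PairPath

section GenericLemmas

variable {ι : Type*} [DecidableEq ι] [Fintype ι]

/-- An indicator choosing between two nonnegative quantities is nonnegative. -/
private theorem ite_nonneg_of {P : Prop} [Decidable P] {a b : ℝ} (ha : 0 ≤ a) (hb : 0 ≤ b) :
    0 ≤ (if P then a else b) := by
  split_ifs <;> assumption

omit [Fintype ι] in
/-- A two-point indicator at distinct points `p ≠ q` is the sum of the two one-point indicators. -/
private theorem ite_ite_eq_add {p q : ι} (hpq : p ≠ q) (x y : ℝ) (i : ι) :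
    (if i = p then x else if i = q then y else 0) = (if i = p then x else 0) + (if i = q then y else 0) := by
  by_cases hp : i = p
  · simp [hp, hpq]
  · simp [hp]

/-- MARK SHIFT inside the summation box: `Σ_{t<U} [d ≤ t] F (t − d) = Σ_{t<U} F t` for `d ≤ 1 ≤ U` when the top
layer `F (U − 1)` is empty (no mass is shifted out of the box). -/
private theorem sum_range_shift (F : ℕ → ℝ) {d U : ℕ} (hd : d ≤ 1) (hU : 1 ≤ U) (hF : F (U - 1) = 0) :
    ∑ t ∈ Finset.range U, (if d ≤ t then F (t - d) else 0) = ∑ t ∈ Finset.range U, F t := by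
  obtain ⟨V, rfl⟩ : ∃ V, U = V + 1 := ⟨U - 1, by omega⟩
  interval_cases d
  · simp
  · rw [Finset.sum_range_succ', Finset.sum_range_succ]; simp only [Nat.add_sub_cancel] at hF; simp [hF]

omit [DecidableEq ι] in
/-- Moving one mark sum inside the two particle sums. -/
private theorem sum_comm₃ {α : Type*} (S : Finset α) (X : α → ι → ι → ℝ) :
    ∑ a ∈ S, ∑ i', ∑ j', X a i' j' = ∑ i', ∑ j', ∑ a ∈ S, X a i' j' := by
  rw [Finset.sum_comm]; exact Finset.sum_congr rfl fun _ _ => Finset.sum_comm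

omit [DecidableEq ι] in
/-- Moving two mark sums inside the two particle sums. -/
private theorem sum_comm₄ {α β : Type*} (S₁ : Finset α) (S₂ : Finset β) (X : α → β → ι → ι → ℝ) :
    ∑ a ∈ S₁, ∑ b ∈ S₂, ∑ i', ∑ j', X a b i' j' = ∑ i', ∑ j', ∑ a ∈ S₁, ∑ b ∈ S₂, X a b i' j' := by
  rw [Finset.sum_congr rfl fun a _ => sum_comm₃ S₂ (X a)]
  exact sum_comm₃ S₁ fun a i' j' => ∑ b ∈ S₂, X a b i' j'

/-- Summing the slot-tag indicator `[g = c₀ ∧ P]` over the tags `g ≤ G`, `c₀ ≤ G`. -/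
private theorem sum_tag_ite {G c₀ : ℕ} (hc₀ : c₀ ≤ G) (P : Prop) [Decidable P] (W : ℝ) :
    ∑ g ∈ Finset.range (G + 1), (if g = c₀ ∧ P then W else 0) = if P then W else 0 := by
  simp_rw [ite_and]; rw [Finset.sum_ite_eq', if_pos (Finset.mem_range.2 (Nat.lt_succ_of_le hc₀))]

/-- Off-diagonal part of the product of two weighted column sums. -/
private theorem sum_offdiag_mul (a u v : ι → ℝ) :
    ∑ i', ∑ j', (if i' = j' then 0 else a i' * a j') * (u i' * v j') =
      (∑ i', a i' * u i') * (∑ j', a j' * v j') - ∑ i', a i' ^ 2 * (u i' * v i') := by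
  have h : ∀ i' j', (if i' = j' then 0 else a i' * a j') * (u i' * v j') =
      a i' * u i' * (a j' * v j') - (if i' = j' then a i' ^ 2 * (u i' * v i') else 0) := by
    intro i' j'
    split_ifs with hij
    · subst hij; ring
    · ring
  simp_rw [h, Finset.sum_sub_distrib, Fintype.sum_ite_eq, Finset.sum_mul_sum]

/-! ### §K The one-tracer kernel -/

omit [Fintype ι] in
/-- Off the reflected pair the kernel is the identity row. [folklore] -/
theorem kstep_of_ne {p q : ι} (f : ι → ℝ) {i' : ι} (hp : i' ≠ p) (hq : i' ≠ q) (i : ι) :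
    kstep p q f i' i = if i = i' then 1 else 0 := by
  rw [kstep, if_neg hp, if_neg hq]

omit [Fintype ι] in
/-- The kernel row of the first endpoint. [folklore] -/
theorem kstep_fst (p q : ι) (f : ι → ℝ) (i : ι) :
    kstep p q f p i = if i = p then 1 - f p else if i = q then f p else 0 := by
  rw [kstep, if_pos rfl]

omit [Fintype ι] in
/-- The kernel row of the second endpoint. [folklore] -/
theorem kstep_snd {p q : ι} (hpq : p ≠ q) (f : ι → ℝ) (i : ι) :
    kstep p q f q i = if i = q then 1 - f q else if i = p then f q else 0 := by
  rw [kstep, if_neg (Ne.symm hpq), if_pos rfl]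

omit [Fintype ι] in
/-- The kernel is nonnegative when the two handed-over fractions lie in `[0, 1]`. [folklore] -/
theorem kstep_nonneg {p q : ι} {f : ι → ℝ} (hp0 : 0 ≤ f p) (hp1 : f p ≤ 1) (hq0 : 0 ≤ f q) (hq1 : f q ≤ 1)
    (i' i : ι) : 0 ≤ kstep p q f i' i := by
  unfold kstep; split_ifs <;> linarith

/-- Rows of the kernel sum to one. [folklore] -/
theorem sum_kstep {p q : ι} (hpq : p ≠ q) (f : ι → ℝ) (i' : ι) : ∑ i, kstep p q f i' i = 1 := by
  by_cases hp : i' = p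
  · subst hp; simp_rw [kstep_fst, ite_ite_eq_add hpq, Finset.sum_add_distrib, Fintype.sum_ite_eq']; ring
  by_cases hq : i' = q
  · subst hq; simp_rw [kstep_snd hpq, ite_ite_eq_add (Ne.symm hpq), Finset.sum_add_distrib, Fintype.sum_ite_eq']; ring
  simp_rw [kstep_of_ne f hp hq, Fintype.sum_ite_eq']

/-- Squared row of the first endpoint: both tracers of a together pair make the same move. [folklore] -/
theorem sum_kstep_sq_fst {p q : ι} (hpq : p ≠ q) (f : ι → ℝ) :
    ∑ i, kstep p q f p i ^ 2 = (1 - f p) ^ 2 + f p ^ 2 := by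
  have h : ∀ i, kstep p q f p i ^ 2 = if i = p then (1 - f p) ^ 2 else if i = q then f p ^ 2 else 0 := by
    intro i; rw [kstep_fst]; split_ifs <;> ring
  simp_rw [h, ite_ite_eq_add hpq, Finset.sum_add_distrib, Fintype.sum_ite_eq']

/-- Squared row of the second endpoint. [folklore] -/
theorem sum_kstep_sq_snd {p q : ι} (hpq : p ≠ q) (f : ι → ℝ) :
    ∑ i, kstep p q f q i ^ 2 = (1 - f q) ^ 2 + f q ^ 2 := by
  have h : ∀ i, kstep p q f q i ^ 2 = if i = q then (1 - f q) ^ 2 else if i = p then f q ^ 2 else 0 := by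
    intro i; rw [kstep_snd hpq]; split_ifs <;> ring
  simp_rw [h, ite_ite_eq_add (Ne.symm hpq), Finset.sum_add_distrib, Fintype.sum_ite_eq']

/-- The product kernel is stochastic. [folklore] -/
theorem sum_sum_kstep_mul {p q : ι} (hpq : p ≠ q) (f : ι → ℝ) (i' j' : ι) :
    ∑ i, ∑ j, kstep p q f i' i * kstep p q f j' j = 1 := by
  rw [← Finset.sum_mul_sum, sum_kstep hpq, sum_kstep hpq, one_mul]

/-- Split mass of the first endpoint: `1 − Σ_i k(p,i)² = 2 f_p (1 − f_p)`. [folklore] -/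
theorem one_sub_sum_kstep_sq_fst {p q : ι} (hpq : p ≠ q) (f : ι → ℝ) :
    1 - ∑ i, kstep p q f p i ^ 2 = 2 * f p * (1 - f p) := by
  rw [sum_kstep_sq_fst hpq]; ring

/-- A weighted diagonal sum against two columns of the kernel: only the rows `p`, `q` and, off the pair, the identity
row contribute. -/
private theorem sum_mul_kstep_mul_kstep {p q : ι} (hpq : p ≠ q) (f : ι → ℝ) (w : ι → ℝ) (i j : ι) :
    ∑ i', w i' * (kstep p q f i' i * kstep p q f i' j) =
      w p * (kstep p q f p i * kstep p q f p j) + w q * (kstep p q f q i * kstep p q f q j) +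
        (if i = p ∨ i = q then 0 else if j = i then w i else 0) := by
  rw [← Finset.add_sum_erase _ _ (Finset.mem_univ p),
    ← Finset.add_sum_erase _ _ (Finset.mem_erase.2 ⟨Ne.symm hpq, Finset.mem_univ q⟩), ← add_assoc]
  congr 1
  have hS : ∀ i' ∈ (Finset.univ.erase p).erase q, w i' * (kstep p q f i' i * kstep p q f i' j) =
      if i = i' then (if j = i then w i else 0) else 0 := by
    intro i' hi'
    simp only [Finset.mem_erase, Finset.mem_univ, and_true] at hi'
    rw [kstep_of_ne f hi'.2 hi'.1, kstep_of_ne f hi'.2 hi'.1]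
    by_cases h : i = i' <;> simp [h]
  rw [Finset.sum_congr rfl hS, Finset.sum_ite_eq]
  by_cases hp : i = p
  · simp [hp]
  by_cases hq : i = q
  · simp [hq]
  simp [hp, hq]

/-! ### §M Mark sums and the marginal (product-law) identities -/

/-- Together profile summed over the marks `s, t < U`. -/
def sT (U : ℕ) (T : ι → ℕ → ℕ → ℝ) (i : ι) : ℝ :=
  ∑ s ∈ Finset.range U, ∑ t ∈ Finset.range U, T i s t

/-- Apart profile summed over the marks `s, t < U`, `g ≤ G`. -/
def sA (U G : ℕ) (A : ι → ι → ℕ → ℕ → ℕ → ℝ) (i j : ι) : ℝ :=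
  ∑ s ∈ Finset.range U, ∑ t ∈ Finset.range U, ∑ g ∈ Finset.range (G + 1), A i j s t g

/-- MARGINAL OF ONE EVENT, together profile: summing the marks of `stepT` (the top mark value `t = U − 1` being empty
before the event, so that no mass is shifted out of the summation box). [folklore] -/
theorem sT_stepT {p q : ι} (_hpq : p ≠ q) (f : ι → ℝ) {δ : ι → ℕ} (hδ : ∀ i, δ i ≤ 1) {U : ℕ} (hU : 1 ≤ U) (G : ℕ)
    {T : ι → ℕ → ℕ → ℝ} {A : ι → ι → ℕ → ℕ → ℕ → ℝ} (hTt : ∀ i s, T i s (U - 1) = 0) (i : ι) :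
    sT U (stepT p q f δ G T A) i =
      (if i = p ∨ i = q then 0 else sT U T i) + kstep p q f p i ^ 2 * sT U T p + kstep p q f q i ^ 2 * sT U T q +
        ∑ i', ∑ j', sA U G A i' j' * (kstep p q f i' i * kstep p q f j' i) := by
  have h1 : ∑ s ∈ Finset.range U, ∑ t ∈ Finset.range U, (if i = p ∨ i = q then (0 : ℝ) else T i s t) =
      if i = p ∨ i = q then (0 : ℝ) else ∑ s ∈ Finset.range U, ∑ t ∈ Finset.range U, T i s t := by
    by_cases h : i = p ∨ i = q <;> simp [h]
  have h2 : ∀ r : ι, ∑ s ∈ Finset.range U, ∑ t ∈ Finset.range U,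
      (if δ r ≤ t then kstep p q f r i ^ 2 * T r s (t - δ r) else 0) =
      kstep p q f r i ^ 2 * ∑ s ∈ Finset.range U, ∑ t ∈ Finset.range U, T r s t := by
    intro r; rw [Finset.mul_sum]
    refine Finset.sum_congr rfl fun s _ => ?_
    rw [Finset.mul_sum]
    exact sum_range_shift (fun t => kstep p q f r i ^ 2 * T r s t) (hδ r) hU (by simp [hTt])
  have h4 : ∑ s ∈ Finset.range U, ∑ t ∈ Finset.range U, ∑ i', ∑ j', ∑ g ∈ Finset.range (G + 1),
      A i' j' s t g * (kstep p q f i' i * kstep p q f j' i) =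
      ∑ i', ∑ j', (∑ s ∈ Finset.range U, ∑ t ∈ Finset.range U, ∑ g ∈ Finset.range (G + 1), A i' j' s t g) *
        (kstep p q f i' i * kstep p q f j' i) := by
    simp only [Finset.sum_mul]
    exact sum_comm₄ _ _ fun s t i' j' =>
      ∑ g ∈ Finset.range (G + 1), A i' j' s t g * (kstep p q f i' i * kstep p q f j' i)
  simp only [sT, sA, stepT, Finset.sum_add_distrib]
  rw [h1, h2 p, h2 q, h4]

/-- MARGINAL OF ONE EVENT, apart profile. [folklore] -/
theorem sA_stepA {p q : ι} (_hpq : p ≠ q) (f : ι → ℝ) {δ : ι → ℕ} (hδ : ∀ i, δ i ≤ 1) {U : ℕ} (hU : 1 ≤ U) {G c₀ : ℕ}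
    (hc₀ : c₀ ≤ G) {T : ι → ℕ → ℕ → ℝ} {A : ι → ι → ℕ → ℕ → ℕ → ℝ} (hTs : ∀ i t, T i (U - 1) t = 0)
    (hTt : ∀ i s, T i s (U - 1) = 0) (i j : ι) :
    sA U G (stepA p q f δ c₀ T A) i j =
      if i = j then 0 else
        (∑ i', ∑ j', sA U G A i' j' * (kstep p q f i' i * kstep p q f j' j)) +
          (sT U T p * (kstep p q f p i * kstep p q f p j) + sT U T q * (kstep p q f q i * kstep p q f q j)) := by
  by_cases hij : i = j
  · subst hij
    simp [sA, stepA]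
  rw [if_neg hij]
  have h4 : ∑ s ∈ Finset.range U, ∑ t ∈ Finset.range U, ∑ g ∈ Finset.range (G + 1), ∑ i', ∑ j',
      A i' j' s t g * (kstep p q f i' i * kstep p q f j' j) =
      ∑ i', ∑ j', (∑ s ∈ Finset.range U, ∑ t ∈ Finset.range U, ∑ g ∈ Finset.range (G + 1), A i' j' s t g) *
        (kstep p q f i' i * kstep p q f j' j) := by
    simp only [Finset.sum_mul]
    rw [Finset.sum_congr rfl fun s _ => Finset.sum_congr rfl fun t _ => sum_comm₃ (Finset.range (G + 1))
      fun g i' j' => A i' j' s t g * (kstep p q f i' i * kstep p q f j' j)]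
    exact sum_comm₄ _ _ fun s t i' j' =>
      ∑ g ∈ Finset.range (G + 1), A i' j' s t g * (kstep p q f i' i * kstep p q f j' j)
  have hshift : ∀ r : ι, ∑ s ∈ Finset.range U, ∑ t ∈ Finset.range U,
      (if δ r ≤ t then T r s (t - δ r) * (kstep p q f r i * kstep p q f r j) else 0) =
      (∑ s ∈ Finset.range U, ∑ t ∈ Finset.range U, T r s t) * (kstep p q f r i * kstep p q f r j) := by
    intro r; rw [Finset.sum_mul]
    refine Finset.sum_congr rfl fun s _ => ?_
    rw [Finset.sum_mul]
    exact sum_range_shift (fun t => T r s t * (kstep p q f r i * kstep p q f r j)) (hδ r) hU (by simp [hTt])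
  have h5 : ∑ s ∈ Finset.range U, ∑ t ∈ Finset.range U, ∑ g ∈ Finset.range (G + 1),
      (if g = c₀ ∧ 1 ≤ s then
        (if δ p ≤ t then T p (s - 1) (t - δ p) * (kstep p q f p i * kstep p q f p j) else 0) +
          (if δ q ≤ t then T q (s - 1) (t - δ q) * (kstep p q f q i * kstep p q f q j) else 0) else 0) =
      (∑ s ∈ Finset.range U, ∑ t ∈ Finset.range U, T p s t) * (kstep p q f p i * kstep p q f p j) +
        (∑ s ∈ Finset.range U, ∑ t ∈ Finset.range U, T q s t) * (kstep p q f q i * kstep p q f q j) := by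
    rw [← hshift p, ← hshift q, ← Finset.sum_add_distrib,
      ← sum_range_shift (fun s => (∑ t ∈ Finset.range U,
          (if δ p ≤ t then T p s (t - δ p) * (kstep p q f p i * kstep p q f p j) else 0)) +
        ∑ t ∈ Finset.range U, (if δ q ≤ t then T q s (t - δ q) * (kstep p q f q i * kstep p q f q j) else 0))
        le_rfl hU (by simp [hTs])]
    refine Finset.sum_congr rfl fun s _ => ?_
    simp_rw [sum_tag_ite hc₀]
    split_ifs
    · exact Finset.sum_add_distrib
    · simp
  simp only [sA, sT, stepA, if_neg hij, Finset.sum_add_distrib]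
  rw [h4, h5]

/-- THE PRODUCT LAW IS PRESERVED: if the mark sums of `(T, A)` are `(a², a ⊗ a off the diagonal)` then after one event they
are those of the transported law `a' i = Σ_{i'} a i' k(i', i)`. [folklore] -/
theorem product_step {p q : ι} (hpq : p ≠ q) (f : ι → ℝ) {δ : ι → ℕ} (hδ : ∀ i, δ i ≤ 1) {U : ℕ} (hU : 1 ≤ U) {G c₀ : ℕ}
    (hc₀ : c₀ ≤ G) {T : ι → ℕ → ℕ → ℝ} {A : ι → ι → ℕ → ℕ → ℕ → ℝ} (hTs : ∀ i t, T i (U - 1) t = 0)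
    (hTt : ∀ i s, T i s (U - 1) = 0) {a : ι → ℝ} (hT : ∀ i, sT U T i = a i ^ 2)
    (hA : ∀ i j, sA U G A i j = if i = j then 0 else a i * a j) :
    (∀ i, sT U (stepT p q f δ G T A) i = (∑ i', a i' * kstep p q f i' i) ^ 2) ∧
      (∀ i j, sA U G (stepA p q f δ c₀ T A) i j =
        if i = j then 0 else (∑ i', a i' * kstep p q f i' i) * (∑ j', a j' * kstep p q f j' j)) := by
  have hdiag : ∀ i j, ∑ i', a i' ^ 2 * (kstep p q f i' i * kstep p q f i' j) =
      a p ^ 2 * (kstep p q f p i * kstep p q f p j) + a q ^ 2 * (kstep p q f q i * kstep p q f q j) +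
        (if i = p ∨ i = q then 0 else if j = i then a i ^ 2 else 0) :=
    fun i j => sum_mul_kstep_mul_kstep hpq f (fun i' => a i' ^ 2) i j
  have hoff : ∀ i j, ∑ i', ∑ j', (if i' = j' then 0 else a i' * a j') * (kstep p q f i' i * kstep p q f j' j) =
      (∑ i', a i' * kstep p q f i' i) * (∑ j', a j' * kstep p q f j' j) -
        ∑ i', a i' ^ 2 * (kstep p q f i' i * kstep p q f i' j) :=
    fun i j => sum_offdiag_mul a (fun i' => kstep p q f i' i) fun j' => kstep p q f j' j
  refine ⟨fun i => ?_, fun i j => ?_⟩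
  · rw [sT_stepT hpq f hδ hU G hTt]
    simp only [hT, hA]
    rw [hoff, hdiag, if_pos rfl]
    split_ifs <;> ring
  · rw [sA_stepA hpq f hδ hU hc₀ hTs hTt]
    simp only [hT, hA]
    by_cases hij : i = j
    · simp only [if_pos hij]
    · simp only [if_neg hij]; rw [hoff, hdiag, if_neg (Ne.symm hij)]; split_ifs <;> ring

/-! ### §S Support, nonnegativity, diagonal -/

/-- The apart profile after an event vanishes on the diagonal. [folklore] -/
theorem stepA_diag (p q : ι) (f : ι → ℝ) (δ : ι → ℕ) (c₀ : ℕ) (T : ι → ℕ → ℕ → ℝ)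
    (A : ι → ι → ℕ → ℕ → ℕ → ℝ) (i : ι) (s t g : ℕ) : stepA p q f δ c₀ T A i i s t g = 0 := by
  simp [stepA]

/-- Nonnegativity is preserved by one event. [folklore] -/
theorem step_nonneg {p q : ι} {f : ι → ℝ} (hp0 : 0 ≤ f p) (hp1 : f p ≤ 1) (hq0 : 0 ≤ f q) (hq1 : f q ≤ 1)
    (δ : ι → ℕ) (G c₀ : ℕ) {T : ι → ℕ → ℕ → ℝ} {A : ι → ι → ℕ → ℕ → ℕ → ℝ} (hT : ∀ i s t, 0 ≤ T i s t)
    (hA : ∀ i j s t g, 0 ≤ A i j s t g) :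
    (∀ i s t, 0 ≤ stepT p q f δ G T A i s t) ∧ (∀ i j s t g, 0 ≤ stepA p q f δ c₀ T A i j s t g) := by
  have hk : ∀ i' i, 0 ≤ kstep p q f i' i := kstep_nonneg hp0 hp1 hq0 hq1
  have hkk : ∀ i' j' i j, 0 ≤ kstep p q f i' i * kstep p q f j' j := fun _ _ _ _ =>
    mul_nonneg (hk _ _) (hk _ _)
  refine ⟨fun i s t => ?_, fun i j s t g => ?_⟩
  · simp only [stepT]
    exact add_nonneg (add_nonneg (add_nonneg (ite_nonneg_of le_rfl (hT _ _ _))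
      (ite_nonneg_of (mul_nonneg (sq_nonneg _) (hT _ _ _)) le_rfl))
      (ite_nonneg_of (mul_nonneg (sq_nonneg _) (hT _ _ _)) le_rfl))
      (Finset.sum_nonneg fun _ _ => Finset.sum_nonneg fun _ _ => Finset.sum_nonneg fun _ _ =>
        mul_nonneg (hA _ _ _ _ _) (hkk _ _ _ _))
  · simp only [stepA]
    exact ite_nonneg_of le_rfl (add_nonneg
      (Finset.sum_nonneg fun _ _ => Finset.sum_nonneg fun _ _ => mul_nonneg (hA _ _ _ _ _) (hkk _ _ _ _))
      (ite_nonneg_of (add_nonneg (ite_nonneg_of (mul_nonneg (hT _ _ _) (hkk _ _ _ _)) le_rfl)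
        (ite_nonneg_of (mul_nonneg (hT _ _ _) (hkk _ _ _ _)) le_rfl)) le_rfl))

/-- SUPPORT PROPAGATION: if `T` lives on `s < Ks, t < Kt` and `A` on `s < Ks, t < Kt, g ≤ G'`, then after one event `T`
lives on `s < Ks, t < Kt + 1` and `A` on `s < Ks + 1, t < Kt + 1, (g ≤ G' ∨ g = c₀)`. [folklore] -/
theorem step_support (p q : ι) (f : ι → ℝ) {δ : ι → ℕ} (hδ : ∀ i, δ i ≤ 1) (G c₀ : ℕ) {Ks Kt G' : ℕ}
    {T : ι → ℕ → ℕ → ℝ} {A : ι → ι → ℕ → ℕ → ℕ → ℝ}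
    (hT : ∀ i s t, (Ks ≤ s ∨ Kt ≤ t) → T i s t = 0)
    (hA : ∀ i j s t g, (Ks ≤ s ∨ Kt ≤ t ∨ G' < g) → A i j s t g = 0) :
    (∀ i s t, (Ks ≤ s ∨ Kt + 1 ≤ t) → stepT p q f δ G T A i s t = 0) ∧
      (∀ i j s t g, (Ks + 1 ≤ s ∨ Kt + 1 ≤ t ∨ (G' < g ∧ g ≠ c₀)) → stepA p q f δ c₀ T A i j s t g = 0) := by
  refine ⟨fun i s t hst => ?_, fun i j s t g hstg => ?_⟩
  · have h0 : T i s t = 0 := hT i s t (by omega)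
    have hr : ∀ r : ι, (if δ r ≤ t then kstep p q f r i ^ 2 * T r s (t - δ r) else 0) = 0 := fun r =>
      ite_eq_right_iff.2 fun h => by rw [hT r s _ (by have := hδ r; omega), mul_zero]
    have hA0 : ∀ i' j' g, A i' j' s t g = 0 := fun i' j' g => hA i' j' s t g (by omega)
    simp only [stepT, h0, ite_self, hr, hA0, zero_mul, Finset.sum_const_zero, add_zero]
  · by_cases hij : i = j
    · subst hij
      exact stepA_diag p q f δ c₀ T A i s t g
    · have hA0 : ∀ i' j', A i' j' s t g = 0 := fun i' j' => hA i' j' s t g (by omega)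
      have hr : ∀ r : ι, g = c₀ ∧ 1 ≤ s →
          (if δ r ≤ t then T r (s - 1) (t - δ r) * (kstep p q f r i * kstep p q f r j) else 0) = 0 :=
        fun r h1 => ite_eq_right_iff.2 fun h => by rw [hT r _ _ (by have := hδ r; omega), zero_mul]
      have hsplit : (if g = c₀ ∧ 1 ≤ s then
          (if δ p ≤ t then T p (s - 1) (t - δ p) * (kstep p q f p i * kstep p q f p j) else 0) +
            (if δ q ≤ t then T q (s - 1) (t - δ q) * (kstep p q f q i * kstep p q f q j) else 0) else 0) = 0 :=
        ite_eq_right_iff.2 fun h1 => by rw [hr p h1, hr q h1, add_zero]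
      simp only [stepA, if_neg hij, hsplit, hA0, zero_mul, Finset.sum_const_zero, add_zero]

/-- Apart mass created by an event carries at least one split: if `A` vanishes at `s = 0`, so does `stepA`. [folklore] -/
theorem stepA_zero_splits (p q : ι) (f : ι → ℝ) (δ : ι → ℕ) (c₀ : ℕ) (T : ι → ℕ → ℕ → ℝ)
    {A : ι → ι → ℕ → ℕ → ℕ → ℝ} (hA : ∀ i j t g, A i j 0 t g = 0) (i j : ι) (t g : ℕ) :
    stepA p q f δ c₀ T A i j 0 t g = 0 := by
  simp [stepA, hA]

/-! ### §D Domination below a tag: apart mass with an OLD tag receives no inflow -/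

/-- Apart profile summed over `s, t < U` and the tags `g ≤ r` only. -/
def sAle (U r : ℕ) (A : ι → ι → ℕ → ℕ → ℕ → ℝ) (i j : ι) : ℝ :=
  ∑ s ∈ Finset.range U, ∑ t ∈ Finset.range U, ∑ g ∈ Finset.range (r + 1), A i j s t g

/-- OLD TAGS ARE ONLY TRANSPORTED: if the current tag `c₀` exceeds `r`, the apart mass with tags `≤ r` after the event is the
product-kernel transport (off the diagonal) of the apart mass with tags `≤ r` before it. [folklore] -/
theorem sAle_stepA {p q : ι} (_hpq : p ≠ q) (f : ι → ℝ) (δ : ι → ℕ) {c₀ r : ℕ} (hr : r < c₀) (U : ℕ)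
    (T : ι → ℕ → ℕ → ℝ) (A : ι → ι → ℕ → ℕ → ℕ → ℝ) (i j : ι) :
    sAle U r (stepA p q f δ c₀ T A) i j =
      if i = j then 0 else ∑ i', ∑ j', sAle U r A i' j' * (kstep p q f i' i * kstep p q f j' j) := by
  by_cases hij : i = j
  · subst hij
    simp [sAle, stepA]
  rw [if_neg hij]
  have hg : ∀ s t, ∀ g ∈ Finset.range (r + 1), stepA p q f δ c₀ T A i j s t g =
      ∑ i', ∑ j', A i' j' s t g * (kstep p q f i' i * kstep p q f j' j) := by
    intro s t g hg
    have hgc : ¬(g = c₀ ∧ 1 ≤ s) := fun h => by rw [Finset.mem_range] at hg; omega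
    simp only [stepA, if_neg hij, if_neg hgc, add_zero]
  simp only [sAle]
  rw [Finset.sum_congr rfl fun s _ => Finset.sum_congr rfl fun t _ => Finset.sum_congr rfl (hg s t)]
  simp only [Finset.sum_mul]
  rw [Finset.sum_congr rfl fun s _ => Finset.sum_congr rfl fun t _ => sum_comm₃ (Finset.range (r + 1))
    fun g i' j' => A i' j' s t g * (kstep p q f i' i * kstep p q f j' j)]
  exact sum_comm₄ _ _ fun s t i' j' =>
    ∑ g ∈ Finset.range (r + 1), A i' j' s t g * (kstep p q f i' i * kstep p q f j' j)

/-- MONOTONE COMPARISON of the off-diagonal product transport: if `X ≤ Y` entrywise and the kernel is nonnegative, the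
transported `X` (diagonal removed) is below the transported `Y` (diagonal removed). [folklore] -/
theorem offdiag_transport_mono {p q : ι} {f : ι → ℝ} (hp0 : 0 ≤ f p) (hp1 : f p ≤ 1) (hq0 : 0 ≤ f q) (hq1 : f q ≤ 1)
    {X Y : ι → ι → ℝ} (hXY : ∀ i j, X i j ≤ Y i j) (i j : ι) :
    (if i = j then (0 : ℝ) else ∑ i', ∑ j', X i' j' * (kstep p q f i' i * kstep p q f j' j)) ≤
      (if i = j then (0 : ℝ) else ∑ i', ∑ j', Y i' j' * (kstep p q f i' i * kstep p q f j' j)) := by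
  split_ifs
  · exact le_rfl
  · exact Finset.sum_le_sum fun i' _ => Finset.sum_le_sum fun j' _ =>
      mul_le_mul_of_nonneg_right (hXY i' j')
        (mul_nonneg (kstep_nonneg hp0 hp1 hq0 hq1 i' i) (kstep_nonneg hp0 hp1 hq0 hq1 j' j))

/-- The re-merge flow is monotone in the apart profile. [folklore] -/
theorem remerge_flow_mono {p q : ι} {f : ι → ℝ} (hp0 : 0 ≤ f p) (hp1 : f p ≤ 1) (hq0 : 0 ≤ f q) (hq1 : f q ≤ 1)
    {X Y : ι → ι → ℝ} (hXY : ∀ i j, X i j ≤ Y i j) :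
    ∑ i, ∑ i', ∑ j', X i' j' * (kstep p q f i' i * kstep p q f j' i) ≤
      ∑ i, ∑ i', ∑ j', Y i' j' * (kstep p q f i' i * kstep p q f j' i) := by
  exact Finset.sum_le_sum fun i _ => Finset.sum_le_sum fun i' _ => Finset.sum_le_sum fun j' _ =>
    mul_le_mul_of_nonneg_right (hXY i' j')
      (mul_nonneg (kstep_nonneg hp0 hp1 hq0 hq1 i' i) (kstep_nonneg hp0 hp1 hq0 hq1 j' i))

/-- REGISTERED HEADLINE (sub-goal `pairPath_product_step`): the product law is preserved by one event, at `ι = Fin (N+1)`. [folklore] -/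
theorem pairPath_product_step : ∀ (N : ℕ) (p q : Fin (N + 1)), p ≠ q → ∀ (f : Fin (N + 1) → ℝ) (δ : Fin (N + 1) → ℕ), (∀ i, δ i ≤ 1) → ∀ (U : ℕ), 1 ≤ U → ∀ (G c₀ : ℕ), c₀ ≤ G → ∀ (T : Fin (N + 1) → ℕ → ℕ → ℝ) (A : Fin (N + 1) → Fin (N + 1) → ℕ → ℕ → ℕ → ℝ), (∀ i t, T i (U - 1) t = 0) → (∀ i s, T i s (U - 1) = 0) → ∀ (a : Fin (N + 1) → ℝ), (∀ i, PairPath.sT U T i = a i ^ 2) → (∀ i j, PairPath.sA U G A i j = if i = j then 0 else a i * a j) → (∀ i, PairPath.sT U (PairPath.stepT p q f δ G T A) i = (∑ i', a i' * PairPath.kstep p q f i' i) ^ 2) ∧ (∀ i j, PairPath.sA U G (PairPath.stepA p q f δ c₀ T A) i j = if i = j then 0 else (∑ i', a i' * PairPath.kstep p q f i' i) * (∑ j', a j' * PairPath.kstep p q f j' j)) :=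
  fun _ _ _ hpq f _ hδ _ hU _ _ hc₀ _ _ hTs hTt _ hT hA => product_step hpq f hδ hU hc₀ hTs hTt hT hA

end GenericLemmas

end PairPath

end

end Summit.AtomisticToContinuum.HydrodynamicLimit.Theorems.DiffuseBackwardInfluenceShare
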